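import Mathlib
import Summits.Ventures.PercRepro2.SwOutCrossJunctionDefs
import Summits.Ventures.PercRepro2.SwOutArmThm
import Summits.Ventures.PercRepro2.SwOutArmSw

/-!
# The cross junction with the mark AT the junction (blind cell PercRepro2, night-4 g26,
2026-08-28; proofs/NIGHT4-G26.md §1)

NIGHT4-G25.md §7′ item 3(a) listed «the mark at the junction» (`o = u`) as a remaining boundary
of Theorem A_cross (the junction theorems assume `o ≠ u`) and censused it true (173 classes /
23,269 `Q`-points, 0 Hall failures).  It is NOT a boundary of the statement nor a new block
theorem: when the mark is the junction, every `Q`-point has `u ∈ C_R(l)`, so `u` is never in the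
core of `h` (a red path `h – u – l` would put `h` into the hull of `l`), and since every other
vertex of `U ∖ {h}` carries an outside edge or no edge, every `Q`-point of every class is
CORE-FREE — the ARM PRINCIPLE of g10 (`rigidOK_of_outEdges'`, `SwOutArmThm`) gives the rigid
inequality directly.  The dropped vertices, the cross graph, the u-arms and the block theorem
play no role.

* `CrossJunctionU`: the fields of `CrossJunction` with `o = u` (no `hou`, `hop`);
* **`CrossJunctionU.rigidOK_of_crossJunctionU`**: the rigid inequality on every class;
* `CrossJunctionU.reducible_of_crossJunctionU`, **`swAll_of_crossJunctionU`**,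
  **`sw_of_crossJunctionU`**: rows 2′SW-ALL and (SW) with the mark at the junction — on every
  graph in which some vertex `u ≠ l, h` is the mark and every other vertex of `V ∖ {l, h}` is
  joined to `l` or isolated;
* `CrossJunctionU.of_fields`: the structure from the fields of a `CrossJunction`
  read with `o := u` (a `CrossJunction … o` with `o = u` cannot exist: `hou`).
-/

namespace Summit.Ventures.PercRepro2

namespace CrossArm

open Hull LocRows

variable {V : Type*} {E : Type*} [Fintype E] [DecidableEq E]

open scoped Classical

variable {ends : E → Sym2 V}

section Vocabulary

variable {X : Type*}

/-- **The cross junction with the mark at the junction**: the fields of `CrossJunction` with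
`o = u` (the dropped vertices `p i` forming the cross-edge graph `G`; every other vertex of
`U ∖ {h, u}` carries an outside edge or no edge). -/
structure CrossJunctionU (ends : E → Sym2 V) (U : Set V) (h u : V) (p : X → V)
    (G : SimpleGraph X) : Prop where
  hne_hu : h ≠ u
  hne_hp : ∀ i, h ≠ p i
  hne_up : ∀ i, u ≠ p i
  p_inj : Function.Injective p
  hhU : h ∈ U
  huU : u ∈ U
  hpU : ∀ i, p i ∈ U
  hloop_h : ∀ e, ends e ≠ s(h, h)
  hloop_u : ∀ e, ends e ≠ s(u, u)
  hnadj : ∀ e, ends e ≠ s(h, u)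
  hnadj_p : ∀ i e, ends e ≠ s(h, p i)
  hup : ∀ i, ∃ e, ends e = s(u, p i)
  hcross : ∀ i j, G.Adj i j → ∃ e, ends e = s(p i, p j)
  hcross_adj : ∀ i j e, ends e = s(p i, p j) → G.Adj i j
  hcross_simple : ∀ i j e e', ends e = s(p i, p j) → ends e' = s(p i, p j) → e = e'
  hu_adj_h : ∀ e x, ends e = s(u, x) → (∀ i, x ≠ p i) → ∃ e', ends e' = s(x, h)
  hp_in : ∀ i e x, ends e = s(p i, x) → x ∈ U → x = u ∨ ∃ j, x = p j
  /-- every vertex of `U ∖ {h, u}` carries an outside edge or no edge (the mark is `u`). -/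
  hout : ∀ x ∈ U, x ≠ h → x ≠ u →
    (∃ e y, ends e = s(x, y) ∧ y ∉ U) ∨ (∀ e, x ∉ ends e)

end Vocabulary

section Thm

variable {X : Type*} {U : Set V} {l h u : V} {p : X → V} {G : SimpleGraph X}

/-- **The rigid inequality on every class of a cross junction whose mark is the junction**, for
every outside colouring: every `Q`-point is core-free (`u ∈ C_R(l)` keeps `u` out of the core of
`h`; every other vertex of `U ∖ {h}` carries an outside edge or no edge), and the arm principle
applies. -/
theorem CrossJunctionU.rigidOK_of_crossJunctionU (hj : CrossJunctionU ends U h u p G)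
    (hl : l ∉ U) (ξ : Config E) : RigidOK ends l h u U ξ :=
  fun _ h𝓔 => rigidOK_of_outEdges' (ξ := ξ) hl hj.hloop_h
    (fun x hx hxh hxu => hj.hout x hx hxh hxu) h𝓔

/-- A region with a cross junction whose mark is the junction is a base region of the series
reduction. -/
theorem CrossJunctionU.reducible_of_crossJunctionU (hj : CrossJunctionU ends U h u p G)
    (hl : l ∉ U) : Reducible l h u ends U :=
  Reducible.base ends U fun ξ => hj.rigidOK_of_crossJunctionU hl ξ

/-- **Row 2′SW-ALL on every graph with a cross junction whose mark is the junction.** -/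
theorem swAll_of_crossJunctionU (hlh : l ≠ h) (hj : CrossJunctionU ends ({l}ᶜ) h u p G) :
    SwAll ends l h u :=
  swAll_of_reducible l h u hlh (hj.reducible_of_crossJunctionU (by simp))

/-- **Row (SW) on every graph with a cross junction whose mark is the junction.** -/
theorem sw_of_crossJunctionU (hlh : l ≠ h) (hj : CrossJunctionU ends ({l}ᶜ) h u p G) :
    Sw ends l h u :=
  sw_of_swAll ends (swAll_of_crossJunctionU hlh hj)

omit [Fintype E] [DecidableEq E] in
/-- The structure from the fields of a `CrossJunction` read with the mark at `u`: every field
of `CrossJunction ends U h u p G o` other than `hou`, `hop` and `hout` is stated without `o`,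
and `hout` with `o := u` is the junction's `hout`.  (Stated on the fields, since a
`CrossJunction … o` with `o = u` contradicts its own `hou`.) -/
theorem CrossJunctionU.of_fields (hne_hu : h ≠ u) (hne_hp : ∀ i, h ≠ p i) (hne_up : ∀ i, u ≠ p i)
    (p_inj : Function.Injective p) (hhU : h ∈ U) (huU : u ∈ U) (hpU : ∀ i, p i ∈ U)
    (hloop_h : ∀ e, ends e ≠ s(h, h)) (hloop_u : ∀ e, ends e ≠ s(u, u))
    (hnadj : ∀ e, ends e ≠ s(h, u)) (hnadj_p : ∀ i e, ends e ≠ s(h, p i))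
    (hup : ∀ i, ∃ e, ends e = s(u, p i)) (hcross : ∀ i j, G.Adj i j → ∃ e, ends e = s(p i, p j))
    (hcross_adj : ∀ i j e, ends e = s(p i, p j) → G.Adj i j)
    (hcross_simple : ∀ i j e e', ends e = s(p i, p j) → ends e' = s(p i, p j) → e = e')
    (hu_adj_h : ∀ e x, ends e = s(u, x) → (∀ i, x ≠ p i) → ∃ e', ends e' = s(x, h))
    (hp_in : ∀ i e x, ends e = s(p i, x) → x ∈ U → x = u ∨ ∃ j, x = p j)
    (hout : ∀ x ∈ U, x ≠ h → x ≠ u → x ≠ u →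
      (∃ e y, ends e = s(x, y) ∧ y ∉ U) ∨ (∀ e, x ∉ ends e)) :
    CrossJunctionU ends U h u p G :=
  ⟨hne_hu, hne_hp, hne_up, p_inj, hhU, huU, hpU, hloop_h, hloop_u, hnadj, hnadj_p, hup, hcross,
    hcross_adj, hcross_simple, hu_adj_h, hp_in, fun x hx hxh hxu => hout x hx hxh hxu hxu⟩

end Thm

end CrossArm

end Summit.Ventures.PercRepro2
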